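import Mathlib
import HarnessLib
import Literature.Probability.MarkovChains.IsingGlauber
import Literature.Probability.MarkovChains.DirichletFormComparison
import Literature.Probability.MarkovChains.ErgodicSumVariance

/-!
# Deleting `r` edges changes the Ising Glauber spectral gap by at most `e^{2β(Δ+2r)}` (Levin–Peres–Wilmer Proposition 15.8)

HONEST FRAMING: exact (Metropolis-corrected) sampling algorithms for lattice gauge theory; figures
of merit are autocorrelation/cost numbers at stated couplings and volumes; no continuum-physics claim.

Conventions of `IsingGlauber.lean` (`localSpinSum G σ w = S(σ,w)`, `isingEnergy G σ = H(σ)`,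
`isingZ`, `gibbsLaw G β = μ`, the Glauber dynamics `glauberKernel (gibbsLaw G β)` of eq. (3.12)),
`PeskunOrdering.lean` (`dirichletForm π P f = 𝓔(f)`), `SpectralGapVariational.lean`
(`spectralGap π P = γ`), `DirichletFormComparison.lean` (Lemma 13.18, Remark 13.19) and
`ErgodicSumVariance.lean` (`spectralGap_pos`).  Source: D. A. Levin, Y. Peres (with E. L. Wilmer),
*Markov Chains and Mixing Times*, 2nd ed., AMS 2017 [LevinPeres2017], §15.4 Proposition 15.8 and
its proof (pp. 221–222).  Everything is PROVED (finite sums; 0 named facts).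

Setting: two graphs `G̃ ≤ G` on the same finite vertex set `V` (`Ẽ ⊂ E`), `Δ = maxDegree(G)`,
`r = |E \ Ẽ|` = the number of edges of the difference graph `G \ G̃`, inverse temperature `β ≥ 0`;
`π, P, γ` for `G` and `π̃, P̃, γ̃` for `G̃`.

* `abs_isingEnergy_sub_le` — `|H(σ) − H̃(σ)| ≤ r` (each deleted edge contributes `±1`);
* **(15.20)** `LevinPeres2017_eq_15_20` — `π̃(σ) ≤ e^{2βr} π(σ)`, and `gibbsLaw_le_exp_mul_gibbsLaw_sub`
  — `π(σ) ≤ e^{2βr} π̃(σ)` ("as seen by reversing the roles of `π` and `π̃`")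
  [cite: LevinPeres2017, §15.4 proof of Prop. 15.8, eq. (15.20)];
* `abs_localSpinSum_le_degree` (`|S(σ,w)| ≤ deg(w)`), `heatBath_le_exp_mul_heatBath` (for
  `|a|, |ã| ≤ M`: `eᵃ̃/(eᵃ̃ + e^{−ã}) ≤ e^{2M}·eᵃ/(eᵃ + e^{−a})`), and
  `glauberKernel_sub_le_exp_mul` — **`P̃(σ,τ) ≤ e^{2βΔ} P(σ,τ)`** ("`P(σ,τ) ≥ n⁻¹(1 + e^{2βΔ})⁻¹
  1{P(σ,τ) > 0}` and `P̃(σ,τ) ≤ n⁻¹ e^{2βΔ}/(1 + e^{2βΔ}) …`") [cite: LevinPeres2017, §15.4 proof of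
  Prop. 15.8 (the two displays after (15.20))];
* `dirichletForm_sub_le` — `𝓔̃(f) ≤ e^{2β(Δ+r)} 𝓔(f)` (by (13.2) / Remark 13.19)
  [cite: LevinPeres2017, §15.4 proof of Prop. 15.8 ("by (13.2), `𝓔̃(f) ≤ e^{2β(Δ+r)}𝓔(f)`")];
* **PROPOSITION 15.8** `LevinPeres2017_prop_15_8` — **`γ̃ ≤ e^{2β(Δ+2r)} γ`** (Lemma 13.18 with
  `c = e^{2βr}`), and the printed form `LevinPeres2017_prop_15_8_inv` — **`1/γ ≤ e^{2β(Δ+2r)}/γ̃`**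
  (both gaps are positive: the dynamics are reversible and irreducible) [cite: LevinPeres2017, §15.4
  Prop. 15.8].

SCOPE: `β ≥ 0` (ferromagnetic, as in Chapter 15); the book's `Ẽ ⊂ E` is `G̃ ≤ G` (equality allowed,
`r = 0`).  Context (cell pub-lqcd, venture LatticeQCDFlow): a quantitative "surgery" bound — how much
the relaxation time of single-site heat-bath dynamics can change when couplings are switched off —
of the kind used to compare open and periodic boundary conditions.
-/

namespace Literature.Probability.MarkovChains

open Finset

variable {V : Type*} [Fintype V] [DecidableEq V]
variable {G Gt : SimpleGraph V} [DecidableRel G.Adj] [DecidableRel Gt.Adj]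

/-! ## The energies differ by at most `r` -/

omit [DecidableEq V] in
/-- `Σ_u 1{v ∼ u} = deg(v)` as a real sum. [cite: LevinPeres2017, §1.4 (degree of a vertex)] -/
theorem sum_ite_adj_eq_degree (H : SimpleGraph V) [DecidableRel H.Adj] (v : V) :
    ∑ u, (if H.Adj v u then (1 : ℝ) else 0) = H.degree v := by
  rw [sum_ite, sum_const_zero, add_zero, sum_const, nsmul_eq_mul, mul_one,
    ← SimpleGraph.card_neighborFinset_eq_degree, SimpleGraph.neighborFinset_eq_filter]

/-- **`|H(σ) − H̃(σ)| ≤ r = |E \ Ẽ|`**: each edge of `G` missing from `G̃` contributes `−σ(v)σ(w) ∈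
{±1}` to `H − H̃`. [cite: LevinPeres2017, §15.4 proof of Prop. 15.8 (the factor `e^{±βr}` in the
derivation of (15.20))] -/
theorem abs_isingEnergy_sub_le (hsub : Gt ≤ G) (σ : V → ℤˣ) :
    |isingEnergy G σ - isingEnergy Gt σ| ≤ ((G \ Gt).edgeFinset.card : ℝ) := by
  -- `H − H̃ = −½ Σ_v Σ_u 1{(G \ G̃).Adj v u} σ(v)σ(u)`
  have hdiff : isingEnergy G σ - isingEnergy Gt σ =
      -(1 / 2) * ∑ v, ∑ u, (if (G \ Gt).Adj v u then ((σ v : ℤ) : ℝ) * ((σ u : ℤ) : ℝ) else 0) := by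
    unfold isingEnergy
    rw [← mul_sub, ← sum_sub_distrib]
    congr 1
    refine sum_congr rfl fun v _ => ?_
    rw [← sum_sub_distrib]
    refine sum_congr rfl fun u _ => ?_
    have hsd := SimpleGraph.sdiff_adj G Gt v u
    by_cases hG : G.Adj v u <;> by_cases hGt : Gt.Adj v u
    · rw [if_pos hG, if_pos hGt, if_neg (fun h => (hsd.1 h).2 hGt), sub_self]
    · rw [if_pos hG, if_neg hGt, if_pos (hsd.2 ⟨hG, hGt⟩), sub_zero]
    · exact (hG (hsub hGt)).elim
    · rw [if_neg hG, if_neg hGt, if_neg (fun h => hG (hsd.1 h).1), sub_zero]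
  -- `|σ(v)σ(u)| ≤ 1`
  have hunit : ∀ v u, |(if (G \ Gt).Adj v u then ((σ v : ℤ) : ℝ) * ((σ u : ℤ) : ℝ) else 0)| ≤
      (if (G \ Gt).Adj v u then (1 : ℝ) else 0) := by
    intro v u
    split_ifs
    · rcases Int.units_eq_one_or (σ v) with h | h <;> rcases Int.units_eq_one_or (σ u) with h' | h'
        <;> simp [h, h']
    · simp
  -- `Σ_v Σ_u 1{(G \ G̃).Adj v u} = Σ_v deg_{G \ G̃}(v) = 2r`
  have hdeg : ∑ v, ∑ u, (if (G \ Gt).Adj v u then (1 : ℝ) else 0) = 2 * ((G \ Gt).edgeFinset.card : ℝ) := by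
    simp_rw [sum_ite_adj_eq_degree]
    have h := SimpleGraph.sum_degrees_eq_twice_card_edges (G := G \ Gt)
    have h' : ∑ v, (G \ Gt).degree v = 2 * (G \ Gt).edgeFinset.card := by
      convert h using 3
      ext e
      simp only [SimpleGraph.mem_edgeFinset]
    exact_mod_cast h'
  rw [hdiff, abs_mul, abs_neg, abs_of_pos (by norm_num : (0 : ℝ) < 1 / 2)]
  calc 1 / 2 * |∑ v, ∑ u, (if (G \ Gt).Adj v u then ((σ v : ℤ) : ℝ) * ((σ u : ℤ) : ℝ) else 0)|
      ≤ 1 / 2 * ∑ v, ∑ u, (if (G \ Gt).Adj v u then (1 : ℝ) else 0) := by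
        refine mul_le_mul_of_nonneg_left ?_ (by norm_num)
        refine (abs_sum_le_sum_abs _ _).trans (sum_le_sum fun v _ => ?_)
        exact (abs_sum_le_sum_abs _ _).trans (sum_le_sum fun u _ => hunit v u)
    _ = ((G \ Gt).edgeFinset.card : ℝ) := by rw [hdeg]; ring

/-! ## (15.20): the Gibbs laws are comparable -/

/-- If `|H₁(σ) − H₂(σ)| ≤ R` for all `σ` and `β ≥ 0`, then `μ₂(σ) ≤ e^{2βR} μ₁(σ)` (a factor `e^{βR}`
from the numerator and `e^{βR}` from the partition function). [cite: LevinPeres2017, §15.4 proof of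
Prop. 15.8 (derivation of (15.20))] -/
theorem gibbsLaw_le_exp_mul_of_abs_energy_sub_le {G₁ G₂ : SimpleGraph V} [DecidableRel G₁.Adj]
    [DecidableRel G₂.Adj] {β R : ℝ} (hβ : 0 ≤ β)
    (hR : ∀ σ : V → ℤˣ, |isingEnergy G₁ σ - isingEnergy G₂ σ| ≤ R) (σ : V → ℤˣ) :
    gibbsLaw G₂ β σ ≤ Real.exp (2 * β * R) * gibbsLaw G₁ β σ := by
  -- pointwise: `e^{−βH₂(τ)} ≤ e^{βR} e^{−βH₁(τ)}` and `e^{−βH₁(τ)} ≤ e^{βR} e^{−βH₂(τ)}`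
  have h21 : ∀ τ, Real.exp (-β * isingEnergy G₂ τ) ≤ Real.exp (β * R) * Real.exp (-β * isingEnergy G₁ τ) := by
    intro τ
    rw [← Real.exp_add]
    refine Real.exp_le_exp.2 ?_
    have h := (abs_le.1 (hR τ)).2
    have := mul_nonneg hβ (show (0 : ℝ) ≤ R - (isingEnergy G₁ τ - isingEnergy G₂ τ) by linarith)
    nlinarith
  have h12 : ∀ τ, Real.exp (-β * isingEnergy G₁ τ) ≤ Real.exp (β * R) * Real.exp (-β * isingEnergy G₂ τ) := by
    intro τ
    rw [← Real.exp_add]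
    refine Real.exp_le_exp.2 ?_
    have h := (abs_le.1 (hR τ)).1
    have := mul_nonneg hβ (show (0 : ℝ) ≤ isingEnergy G₁ τ - isingEnergy G₂ τ + R by linarith)
    nlinarith
  -- partition functions: `Z₁ ≤ e^{βR} Z₂`
  have hZ : isingZ G₁ β ≤ Real.exp (β * R) * isingZ G₂ β := by
    unfold isingZ
    rw [mul_sum]
    exact sum_le_sum fun τ _ => h12 τ
  have hZ1 := isingZ_pos (G := G₁) β
  have hZ2 := isingZ_pos (G := G₂) β
  have hE := Real.exp_pos (β * R)
  unfold gibbsLaw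
  rw [div_le_iff₀ hZ2]
  calc Real.exp (-β * isingEnergy G₂ σ) ≤ Real.exp (β * R) * Real.exp (-β * isingEnergy G₁ σ) := h21 σ
    _ = Real.exp (β * R) * (Real.exp (-β * isingEnergy G₁ σ) / isingZ G₁ β) * isingZ G₁ β := by
        field_simp
    _ ≤ Real.exp (β * R) * (Real.exp (-β * isingEnergy G₁ σ) / isingZ G₁ β) *
          (Real.exp (β * R) * isingZ G₂ β) :=
        mul_le_mul_of_nonneg_left hZ (mul_nonneg hE.le
          (div_nonneg (Real.exp_pos _).le hZ1.le))
    _ = Real.exp (2 * β * R) * (Real.exp (-β * isingEnergy G₁ σ) / isingZ G₁ β) * isingZ G₂ β := by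
        rw [show (2 : ℝ) * β * R = β * R + β * R by ring, Real.exp_add]; ring

/-- **(15.20)**: `π̃(σ) ≤ e^{2βr} π(σ)` for `G̃ ≤ G`, `r = |E \ Ẽ|`, `β ≥ 0`.
[cite: LevinPeres2017, §15.4 proof of Prop. 15.8, eq. (15.20)] -/
theorem LevinPeres2017_eq_15_20 (hsub : Gt ≤ G) {β : ℝ} (hβ : 0 ≤ β) (σ : V → ℤˣ) :
    gibbsLaw Gt β σ ≤ Real.exp (2 * β * (G \ Gt).edgeFinset.card) * gibbsLaw G β σ :=
  gibbsLaw_le_exp_mul_of_abs_energy_sub_le hβ (fun τ => abs_isingEnergy_sub_le hsub τ) σ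

/-- **(15.20) reversed**: `π(σ) ≤ e^{2βr} π̃(σ)` ("as seen by reversing the roles of `π` and `π̃` in the
proof of (15.20)"). [cite: LevinPeres2017, §15.4 proof of Prop. 15.8 (sentence before the last
display)] -/
theorem gibbsLaw_le_exp_mul_gibbsLaw_sub (hsub : Gt ≤ G) {β : ℝ} (hβ : 0 ≤ β) (σ : V → ℤˣ) :
    gibbsLaw G β σ ≤ Real.exp (2 * β * (G \ Gt).edgeFinset.card) * gibbsLaw Gt β σ :=
  gibbsLaw_le_exp_mul_of_abs_energy_sub_le hβ
    (fun τ => by rw [abs_sub_comm]; exact abs_isingEnergy_sub_le hsub τ) σ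

/-! ## The transition probabilities are comparable: `P̃ ≤ e^{2βΔ} P` -/

omit [DecidableEq V] in
/-- `|S(σ,w)| ≤ deg(w)`. [cite: LevinPeres2017, §15.4 proof of Prop. 15.8 (the bound `e^{2βΔ}` on the
heat-bath odds)] -/
theorem abs_localSpinSum_le_degree (H : SimpleGraph V) [DecidableRel H.Adj] (σ : V → ℤˣ) (w : V) :
    |localSpinSum H σ w| ≤ H.degree w := by
  unfold localSpinSum
  rw [← sum_ite_adj_eq_degree]
  refine (abs_sum_le_sum_abs _ _).trans (sum_le_sum fun u _ => ?_)
  split_ifs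
  · rcases Int.units_eq_one_or (σ u) with h | h <;> simp [h]
  · simp

/-- The heat-bath probability `eᵃ/(eᵃ + e^{−a})` is increasing in `a`. [cite: LevinPeres2017, §3.3.5
eq. (3.11) (it equals `(1 + tanh a)/2`)] -/
theorem heatBath_mono {a b : ℝ} (hab : a ≤ b) :
    Real.exp a / (Real.exp a + Real.exp (-a)) ≤ Real.exp b / (Real.exp b + Real.exp (-b)) := by
  have ha := Real.exp_pos a; have ha' := Real.exp_pos (-a)
  have hb := Real.exp_pos b; have hb' := Real.exp_pos (-b)
  rw [div_le_div_iff₀ (by linarith) (by linarith)]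
  -- `eᵃ e^{−b} ≤ eᵇ e^{−a}` since `a − b ≤ b − a`
  have key : Real.exp a * Real.exp (-b) ≤ Real.exp b * Real.exp (-a) := by
    rw [← Real.exp_add, ← Real.exp_add]
    exact Real.exp_le_exp.2 (by linarith)
  nlinarith

/-- **Heat-bath odds comparison**: for `|a| ≤ M` and `|ã| ≤ M`,
`eᵃ̃/(eᵃ̃ + e^{−ã}) ≤ e^{2M} · eᵃ/(eᵃ + e^{−a})` (the left side is at most `e^{M}/(e^{M}+e^{−M}) =
e^{2M}/(1+e^{2M})`, the right at least `e^{2M}·(1 + e^{2M})⁻¹`). [cite: LevinPeres2017, §15.4 proof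
of Prop. 15.8 (the two displays after (15.20): `P ≥ n⁻¹(1+e^{2βΔ})⁻¹1{P > 0}`,
`P̃ ≤ n⁻¹e^{2βΔ}(1+e^{2βΔ})⁻¹1{P > 0}`)] -/
theorem heatBath_le_exp_mul_heatBath {a a' M : ℝ} (ha : |a| ≤ M) (hat : |a'| ≤ M) :
    Real.exp a' / (Real.exp a' + Real.exp (-a')) ≤
      Real.exp (2 * M) * (Real.exp a / (Real.exp a + Real.exp (-a))) := by
  have h1 : Real.exp a' / (Real.exp a' + Real.exp (-a')) ≤ Real.exp M / (Real.exp M + Real.exp (-M)) :=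
    heatBath_mono (abs_le.1 hat).2
  have h2 : Real.exp (-M) / (Real.exp (-M) + Real.exp (-(-M))) ≤
      Real.exp a / (Real.exp a + Real.exp (-a)) :=
    heatBath_mono (by linarith [(abs_le.1 ha).1])
  have hM := Real.exp_pos M; have hM' := Real.exp_pos (-M)
  -- `e^{M}/(e^{M}+e^{−M}) = e^{2M} · e^{−M}/(e^{−M}+e^{M})`
  have h3 : Real.exp M / (Real.exp M + Real.exp (-M)) =
      Real.exp (2 * M) * (Real.exp (-M) / (Real.exp (-M) + Real.exp (-(-M)))) := by
    rw [neg_neg, show (2 : ℝ) * M = M - (-M) by ring, Real.exp_sub]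
    field_simp
    ring
  rw [h3] at h1
  exact h1.trans (mul_le_mul_of_nonneg_left h2 (Real.exp_pos _).le)

/-- **`P̃(σ,τ) ≤ e^{2βΔ} P(σ,τ)`** for all `σ, τ` (`Δ = maxDegree(G)`, `G̃ ≤ G`, `β ≥ 0`): both kernels are
(3.12), with heat-bath odds whose exponents are bounded by `βΔ` in absolute value.
[cite: LevinPeres2017, §15.4 proof of Prop. 15.8 ("Combining these two inequalities shows that
`P̃(σ,τ) ≤ e^{2βΔ}P(σ,τ)`")] -/
theorem glauberKernel_sub_le_exp_mul [Nonempty V] (hsub : Gt ≤ G) {β : ℝ} (hβ : 0 ≤ β)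
    (σ τ : V → ℤˣ) :
    glauberKernel (gibbsLaw Gt β) σ τ ≤
      Real.exp (2 * (β * G.maxDegree)) * glauberKernel (gibbsLaw G β) σ τ := by
  rw [LevinPeres2017_eq_3_12, LevinPeres2017_eq_3_12, mul_left_comm (Real.exp _)]
  simp only [mul_sum]
  have hn : (0 : ℝ) ≤ (Fintype.card V : ℝ)⁻¹ := inv_nonneg.2 (Nat.cast_nonneg _)
  refine sum_le_sum fun w _ => mul_le_mul_of_nonneg_left ?_ hn
  by_cases h : AgreeOff σ w τ
  · rw [if_pos h, if_pos h]
    -- exponents `a = βτ(w)S_G(σ,w)`, `ã = βτ(w)S_G̃(σ,w)`, both `≤ βΔ` in absolute value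
    have hs : |((τ w : ℤ) : ℝ)| = 1 := by
      rcases Int.units_eq_one_or (τ w) with h' | h' <;> simp [h']
    have hbound : ∀ (H : SimpleGraph V) [DecidableRel H.Adj], H ≤ G →
        |β * ((τ w : ℤ) : ℝ) * localSpinSum H σ w| ≤ β * G.maxDegree := by
      intro H _ hH
      rw [abs_mul, abs_mul, abs_of_nonneg hβ, hs, mul_one]
      refine mul_le_mul_of_nonneg_left ?_ hβ
      calc |localSpinSum H σ w| ≤ H.degree w := abs_localSpinSum_le_degree H σ w
        _ ≤ G.degree w := by exact_mod_cast SimpleGraph.degree_le_of_le hH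
        _ ≤ G.maxDegree := by exact_mod_cast G.degree_le_maxDegree w
    exact heatBath_le_exp_mul_heatBath (hbound G le_rfl) (hbound Gt hsub)
  · rw [if_neg h, if_neg h, mul_zero]

/-! ## Proposition 15.8 -/

omit [Fintype V] [DecidableEq V] in
/-- On a nonempty vertex set the spin configurations form a nontrivial type (all `+1` vs all `−1`)
— Lemma 13.18's standing assumption `|X| ≥ 2`. [cite: LevinPeres2017, §13.3 Lemma 13.18] -/
theorem spinConfig_nontrivial [Nonempty V] : Nontrivial (V → ℤˣ) :=
  ⟨⟨fun _ => 1, fun _ => -1, fun h => units_ne_neg_self (1 : ℤˣ) (congrFun h (Classical.arbitrary V))⟩⟩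

/-- **`𝓔̃(f) ≤ e^{2β(Δ+r)} 𝓔(f)`** for every `f` (from `π̃P̃ ≤ e^{2β(Δ+r)} πP` entrywise, by (13.2) /
Remark 13.19). [cite: LevinPeres2017, §15.4 proof of Prop. 15.8 ("by (13.2), `𝓔̃(f) ≤
e^{2β(Δ+r)}𝓔(f)` for any function `f`")] -/
theorem dirichletForm_sub_le [Nonempty V] (hsub : Gt ≤ G) {β : ℝ} (hβ : 0 ≤ β) (f : (V → ℤˣ) → ℝ) :
    dirichletForm (gibbsLaw Gt β) (glauberKernel (gibbsLaw Gt β)) f ≤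
      Real.exp (2 * (β * G.maxDegree)) * Real.exp (2 * β * (G \ Gt).edgeFinset.card) *
        dirichletForm (gibbsLaw G β) (glauberKernel (gibbsLaw G β)) f :=
  LevinPeres2017_remark_13_19 (fun σ => (gibbsLaw_pos (G := Gt) β σ).le)
    (glauberKernel_nonneg fun σ => (gibbsLaw_pos (G := Gt) β σ).le)
    (fun σ τ _ => glauberKernel_sub_le_exp_mul hsub hβ σ τ) (LevinPeres2017_eq_15_20 hsub hβ) f

/-- **PROPOSITION 15.8.** Let `G = (V,E)` have maximum degree `Δ`, `|V| = n`, and let `G̃ = (V, Ẽ)`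
with `Ẽ ⊂ E`, `r = |E \ Ẽ|`; `γ`, `γ̃` the spectral gaps of the Glauber dynamics for the Ising model
(`β ≥ 0`) on `G`, `G̃`.  Then **`γ̃ ≤ e^{2β(Δ+2r)} γ`** (Lemma 13.18 with `c = e^{2βr}` and
`α = e^{2β(Δ+r)}`). [cite: LevinPeres2017, §15.4 Prop. 15.8 (proof, last display
"`γ̃ ≤ e^{2β(Δ+2r)}γ`")] -/
theorem LevinPeres2017_prop_15_8 [Nonempty V] (hsub : Gt ≤ G) {β : ℝ} (hβ : 0 ≤ β) :
    spectralGap (gibbsLaw Gt β) (glauberKernel (gibbsLaw Gt β)) ≤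
      Real.exp (2 * β * (G.maxDegree + 2 * (G \ Gt).edgeFinset.card)) *
        spectralGap (gibbsLaw G β) (glauberKernel (gibbsLaw G β)) := by
  haveI : Nontrivial (V → ℤˣ) := spinConfig_nontrivial
  have h := LevinPeres2017_lemma_13_18 (gibbsLaw_pos (G := G) β) (sum_gibbsLaw (G := G) β)
    (gibbsLaw_pos (G := Gt) β) (sum_gibbsLaw (G := Gt) β)
    (glauberKernel_isRowStochastic (gibbsLaw_pos (G := G) β)) (isingGlauber_detailedBalance (G := G) β)
    (glauberKernel_isRowStochastic (gibbsLaw_pos (G := Gt) β))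
    (isingGlauber_detailedBalance (G := Gt) β) (dirichletForm_sub_le hsub hβ)
    (gibbsLaw_le_exp_mul_gibbsLaw_sub hsub hβ)
  refine h.trans (le_of_eq ?_)
  rw [← Real.exp_add, ← Real.exp_add]
  congr 1
  ring

/-- **PROPOSITION 15.8, as printed: `1/γ ≤ e^{2β(Δ+2r)}/γ̃`** (both dynamics are reversible and
irreducible, so `γ, γ̃ > 0`). [cite: LevinPeres2017, §15.4 Prop. 15.8] -/
theorem LevinPeres2017_prop_15_8_inv [Nonempty V] (hsub : Gt ≤ G) {β : ℝ} (hβ : 0 ≤ β) :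
    1 / spectralGap (gibbsLaw G β) (glauberKernel (gibbsLaw G β)) ≤
      Real.exp (2 * β * (G.maxDegree + 2 * (G \ Gt).edgeFinset.card)) /
        spectralGap (gibbsLaw Gt β) (glauberKernel (gibbsLaw Gt β)) := by
  haveI : Nontrivial (V → ℤˣ) := spinConfig_nontrivial
  have hγ : 0 < spectralGap (gibbsLaw G β) (glauberKernel (gibbsLaw G β)) :=
    spectralGap_pos (gibbsLaw_pos β) (sum_gibbsLaw β) (glauberKernel_isRowStochastic (gibbsLaw_pos β))
      (isingGlauber_detailedBalance β) (isingGlauber_isIrreducible β)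
  have hγt : 0 < spectralGap (gibbsLaw Gt β) (glauberKernel (gibbsLaw Gt β)) :=
    spectralGap_pos (gibbsLaw_pos β) (sum_gibbsLaw β) (glauberKernel_isRowStochastic (gibbsLaw_pos β))
      (isingGlauber_detailedBalance β) (isingGlauber_isIrreducible β)
  have h := LevinPeres2017_prop_15_8 hsub hβ
  rw [div_le_div_iff₀ hγ hγt, one_mul]
  exact h

end Literature.Probability.MarkovChains
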